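import Literature.AlgebraicGeometry.Frobenioids.ArithmeticFrobenioidDivisorTransportDegree
import Literature.AlgebraicGeometry.Frobenioids.ArithmeticFrobenioidDivisorTransport
import HarnessLib

/-!
# Frobenioids I, Theorem 6.4 (ii)–(iv) at the arithmetic Frobenioids `C_{K/F}`: the degree of `Ψ^Φ`, binder-free

Mochizuki, *The geometry of Frobenioids I*, Kyushu J. Math. **62** (2008), Thm. 6.4 (ii)–(iv) pp. 114–116
[cite: MochizukiFrdI2008, Thm. 6.4 (iii) p.115].

PROOF-ONLY companion (abc-iut-L1-d1 gen 3): the binder-form adapter of `ArithmeticFrobenioidDivisorTransportDegree.lean`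
(row «T64/θ↔rlf ADAPTER») instantiated at THE Cor. 4.11 (iv) datum of an equivalence `Ψ : C_{K₁/F₁} ⥲ C_{K₂/F₂}`
supplied binder-free by `exists_divisorTransport_arith` (`ArithmeticFrobenioidDivisorTransport.lean`, row
«T64iii/θ-SUPPLY»). For EVERY equivalence `Ψ` of arithmetic Frobenioids there are `Ψ^Base` (`1`-unique base square),
`Ψ^Φ`, bijections of finite places `π_L` (generator ↦ generator), the perfected transports `θ_L = (Ψ^Φ_L)^pf`, and ONE
`deg > 0` with: `deg^arith(Ψ^Φ D) = deg · deg^arith(D)`; `d₂ ∘ θ_L = deg · d₁` for any degree extensions `d_i` (the binder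
`hθd` of abc-iut-L1-d9's `thm64iii_of_mulEquiv`); `log N(π_L w) = deg · log N(w)` (the binder `hgen` of abc-iut-L1-t3's
`Thm64iv_of_logNorm_transport_schema`). No definitions; nothing here bears on [IUTchIII] Cor. 3.12.
-/

noncomputable section

namespace Literature.AlgebraicGeometry.Frobenioids

open CategoryTheory Opposite NumberField
open PreFrobenioid

section Arith

variable {F₁ : Type} [Field F₁] [NumberField F₁] {K₁ : Type} [Field K₁] [Algebra F₁ K₁] [IsGalois F₁ K₁]
variable {F₂ : Type} [Field F₂] [NumberField F₂] {K₂ : Type} [Field K₂] [Algebra F₂ K₂] [IsGalois F₂ K₂]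

/-- **Thm. 6.4 (ii)–(iv) at `C_{K/F}`, the transport-and-degree package, binder-free**: for every equivalence
`Ψ : C_{K₁/F₁} ⥲ C_{K₂/F₂}` there are `Ψ^Base : D₁ ⥲ D₂` with its `1`-unique base square (Cor. 4.11 (ii)),
`Ψ^Φ : Φ₁ ⥲ Φ₂` over it (Cor. 4.11 (iii)), finite-place bijections `π_L` with `Ψ^Φ_L(δ_w) = δ_{π_L w}`, the
perfected transports `θ_L := (Ψ^Φ_L)^pf`, and ONE real `deg > 0` (THE degree `deg(Ψ^rlf)` of Thm. 6.4 (ii)) such that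
`deg^arith ∘ Ψ^Φ_L = deg · deg^arith`, `d₂ ∘ θ_L = deg · d₁` for all degree extensions `d_i` of `deg^arith_{L_i}` to the
perfections, and `log N(π_L w) = deg · log N(w)` at every finite place. [cite: MochizukiFrdI2008, Thm. 6.4 (iii) p.115] -/
theorem exists_divisorTransport_deg_arith (Ψ : arithFrobenioid F₁ K₁ ≌ arithFrobenioid F₂ K₂) :
    ∃ (ΨBase : FinSubextCat F₁ K₁ ⥤ FinSubextCat F₂ K₂)
      (E : (arithFrobenioidOps F₁ K₁).DivisorMonoidIsoOverBase (arithFrobenioidOps F₂ K₂) ΨBase)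
      (π : ∀ X : FinSubextCat F₁ K₁, FinitePlace X.L ≃ FinitePlace (ΨBase.obj X).L)
      (θ : ∀ X : FinSubextCat F₁ K₁,
        Perfection (Multiplicative (EffArithDivisor X.L)) ≃*
          Perfection (Multiplicative (EffArithDivisor (ΨBase.obj X).L)))
      (deg : ℝ),
      PreFrobenioidData.OneUniqueSquare Ψ.functor (arithFrobenioidOps F₁ K₁).base
          (arithFrobenioidOps F₂ K₂).base ΨBase ∧
        (∀ (X : FinSubextCat F₁ K₁) (w : FinitePlace X.L),
          E.iso X (Multiplicative.ofAdd (EffArithDivisor.single X.L (Sum.inr w))) =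
            Multiplicative.ofAdd (EffArithDivisor.single (ΨBase.obj X).L (Sum.inr (π X w)))) ∧
        (∀ (X : FinSubextCat F₁ K₁) (D : Multiplicative (EffArithDivisor X.L)) (n : ℕ+),
          θ X (Perfection.mk D n) = Perfection.mk (E.iso X D) n) ∧
        0 < deg ∧
        (∀ (X : FinSubextCat F₁ K₁) (D : EffArithDivisor X.L),
          arithDegree (ΨBase.obj X).L
              (EffArithDivisor.toArithDivisor _ (Multiplicative.toAdd (E.iso X (Multiplicative.ofAdd D)))) =
            deg * arithDegree X.L (EffArithDivisor.toArithDivisor _ D)) ∧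
        (∀ (X : FinSubextCat F₁ K₁)
          (d₁ : Perfection (Multiplicative (EffArithDivisor X.L)) →* Multiplicative ℝ)
          (d₂ : Perfection (Multiplicative (EffArithDivisor (ΨBase.obj X).L)) →* Multiplicative ℝ),
          (∀ D, Multiplicative.toAdd (d₁ (Perfection.of _ (Multiplicative.ofAdd D))) =
            arithDegree X.L (EffArithDivisor.toArithDivisor _ D)) →
          (∀ D, Multiplicative.toAdd (d₂ (Perfection.of _ (Multiplicative.ofAdd D))) =
            arithDegree (ΨBase.obj X).L (EffArithDivisor.toArithDivisor _ D)) →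
          ∀ x, Multiplicative.toAdd (d₂ (θ X x)) = deg * Multiplicative.toAdd (d₁ x)) ∧
        ∀ (X : FinSubextCat F₁ K₁) (w : FinitePlace X.L), logNorm (π X w) = deg * logNorm w := by
  obtain ⟨ΨBase, E, η, π, hsq, -, hπ, hdiv⟩ := exists_divisorTransport_arith Ψ
  haveI : ΨBase.IsEquivalence := hsq.1
  obtain ⟨deg, hpos, hdeg, hθ, hlog⟩ := exists_deg_adapter_of_datum Ψ ΨBase E η hdiv π hπ
  exact ⟨ΨBase, E, π, fun X => Perfection.congr (E.iso X), deg, hsq, hπ, fun X D n => rfl, hpos, hdeg,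
    fun X d₁ d₂ hd₁ hd₂ x => hθ X d₁ d₂ hd₁ hd₂ x, hlog⟩

end Arith

end Literature.AlgebraicGeometry.Frobenioids

end
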